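import Mathlib.Analysis.InnerProductSpace.PiL2
import Mathlib.Tactic
import HarnessLib

/-!
# Mirror pedigrees I: cuts in the nine cubic mirror directions, thresholds, Phase 2

Part of the MIRROR-PEDIGREE toolkit (crux `MoebiusLimitExists`, item stmt-CriticalPhenomena-1344,
refuter `cdisprove` gen 4; full account `Cruxes/MoebiusLimitExists/Disproof.lean` §G): lead-1's
residue `stub_equicontinuity_inner` of line `only-interaction-breaks-moebius` (single-variable
asymptotic equicontinuity of the pinned critical zoom where no coordinate slab separates the moving
point) is reached by reflection-positivity MIRROR arguments alone — the cluster RP–Cauchy–Schwarz move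
inequality reduces regularity at `(x, i)` to regularity at the doubled configuration `A ∪ θA` (far
side discarded), and the COVERING THEOREM ends every such recursion at the lead's base case.
Nothing in these files asserts a Theses statement.

This file: the combinatorial model over `ℝ³` (`Cover.Pt`, `Cover.pcut`, `Cover.HasPedigree`),
membership and coordinate formulas, tiny generic thresholds, and PHASE 2 of the covering theorem
(`Cover.hasPedigree_of_noBlocker`: a configuration without BLOCKERS — points of the closed backward
`ℓ^∞`-pyramid — becomes terminal after the four cuts `e₁+e₃, e₁−e₃, e₁+e₂, e₁−e₂`).
-/

noncomputable section

namespace Summit.CriticalPhenomena.Ising3DConformalLimit.MoebiusLimitExistsNegative.Pedigree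

namespace Cover

open Classical

/-- Points / directions of `ℝ³` as triples. [folklore] -/
abbrev Pt := ℝ × ℝ × ℝ

/-- Dot product. [folklore] -/
def pdot (f v : Pt) : ℝ := f.1 * v.1 + f.2.1 * v.2.1 + f.2.2 * v.2.2

/-- Reflection in the affine mirror `{pdot f · = T}`. [folklore] -/
def prefl (f : Pt) (T : ℝ) (v : Pt) : Pt :=
  (v.1 - 2 * (pdot f v - T) / pdot f f * f.1, v.2.1 - 2 * (pdot f v - T) / pdot f f * f.2.1,
    v.2.2 - 2 * (pdot f v - T) / pdot f f * f.2.2)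

/-- One cut: keep `{pdot f · < T}`, add the mirror images of the kept points. [folklore] -/
def pcut (f : Pt) (T : ℝ) (P : Finset Pt) : Finset Pt :=
  (P.filter fun p => pdot f p < T) ∪ (P.filter fun p => pdot f p < T).image (prefl f T)

/-- The 18 signed cubic reflection directions. [folklore] -/
def dirs : List Pt :=
  [(1,0,0),(0,1,0),(0,0,1),(1,1,0),(1,-1,0),(1,0,1),(1,0,-1),(0,1,1),(0,1,-1),
   (-1,0,0),(0,-1,0),(0,0,-1),(-1,-1,0),(-1,1,0),(-1,0,-1),(-1,0,1),(0,-1,-1),(0,-1,1)]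

/-- MIRROR PEDIGREE (moving point `0`): terminal = `0` strictly extreme in a coordinate direction;
step = an admissible cut (cubic direction, `T > 0`, no point on the mirror). [folklore] -/
inductive HasPedigree : Finset Pt → Prop
  | terminal {P : Finset Pt} (g : Pt) (hg : g ∈ [((1:ℝ),(0:ℝ),(0:ℝ)), (0,1,0), (0,0,1), (-1,0,0), (0,-1,0), (0,0,-1)])
      (h : ∀ p ∈ P, p ≠ 0 → 0 < pdot g p) : HasPedigree P
  | cut {P : Finset Pt} (f : Pt) (T : ℝ) (hf : f ∈ dirs) (hT : 0 < T)
      (hoff : ∀ p ∈ P, pdot f p ≠ T) (h : HasPedigree (pcut f T P)) : HasPedigree P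

/-! ### Membership in a cut -/

/-- Membership in a cut: a kept point or the image of a kept point. [folklore] -/
theorem mem_pcut {f : Pt} {T : ℝ} {P : Finset Pt} {q : Pt} (hq : q ∈ pcut f T P) :
    (q ∈ P ∧ pdot f q < T) ∨ ∃ p ∈ P, pdot f p < T ∧ q = prefl f T p := by
  simp only [pcut, Finset.mem_union, Finset.mem_filter, Finset.mem_image] at hq
  rcases hq with h | ⟨p, ⟨hp, hc⟩, rfl⟩
  · exact Or.inl h
  · exact Or.inr ⟨p, hp, hc, rfl⟩

/-- Kept points belong to the cut. [folklore] -/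
theorem mem_pcut_of_kept {f : Pt} {T : ℝ} {P : Finset Pt} {p : Pt} (hp : p ∈ P) (hc : pdot f p < T) :
    p ∈ pcut f T P := by
  simp only [pcut, Finset.mem_union, Finset.mem_filter]
  exact Or.inl ⟨hp, hc⟩

/-- Images of kept points belong to the cut. [folklore] -/
theorem image_mem_pcut {f : Pt} {T : ℝ} {P : Finset Pt} {p : Pt} (hp : p ∈ P) (hc : pdot f p < T) :
    prefl f T p ∈ pcut f T P := by
  simp only [pcut, Finset.mem_union, Finset.mem_filter, Finset.mem_image]
  exact Or.inr ⟨p, ⟨hp, hc⟩, rfl⟩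

/-! ### The concrete reflections -/

/-- The height functional of a cubic direction, in coordinates. [folklore] -/
@[simp] theorem pdot_101 (v : Pt) : pdot (1,0,1) v = v.1 + v.2.2 := by simp [pdot]
/-- The height functional of a cubic direction, in coordinates. [folklore] -/
@[simp] theorem pdot_10m1 (v : Pt) : pdot (1,0,-1) v = v.1 - v.2.2 := by simp [pdot]; ring
/-- The height functional of a cubic direction, in coordinates. [folklore] -/
@[simp] theorem pdot_110 (v : Pt) : pdot (1,1,0) v = v.1 + v.2.1 := by simp [pdot]
/-- The height functional of a cubic direction, in coordinates. [folklore] -/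
@[simp] theorem pdot_1m10 (v : Pt) : pdot (1,-1,0) v = v.1 - v.2.1 := by simp [pdot]; ring
/-- The height functional of a cubic direction, in coordinates. [folklore] -/
@[simp] theorem pdot_m110 (v : Pt) : pdot (-1,1,0) v = v.2.1 - v.1 := by simp [pdot]; ring
/-- The height functional of a cubic direction, in coordinates. [folklore] -/
@[simp] theorem pdot_010 (v : Pt) : pdot (0,1,0) v = v.2.1 := by simp [pdot]
/-- The height functional of a cubic direction, in coordinates. [folklore] -/
@[simp] theorem pdot_0m10 (v : Pt) : pdot (0,-1,0) v = -v.2.1 := by simp [pdot]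
/-- The height functional of a cubic direction, in coordinates. [folklore] -/
@[simp] theorem pdot_001 (v : Pt) : pdot (0,0,1) v = v.2.2 := by simp [pdot]
/-- The height functional of a cubic direction, in coordinates. [folklore] -/
@[simp] theorem pdot_00m1 (v : Pt) : pdot (0,0,-1) v = -v.2.2 := by simp [pdot]
/-- The height functional of a cubic direction, in coordinates. [folklore] -/
@[simp] theorem pdot_100 (v : Pt) : pdot (1,0,0) v = v.1 := by simp [pdot]

/-- The reflection in a cubic mirror, in coordinates. [folklore] -/
@[simp] theorem prefl_101 (T : ℝ) (v : Pt) : prefl (1,0,1) T v = (T - v.2.2, v.2.1, T - v.1) := by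
  simp only [prefl, pdot, Prod.mk.injEq]; refine ⟨?_, ?_, ?_⟩ <;> ring
/-- The reflection in a cubic mirror, in coordinates. [folklore] -/
@[simp] theorem prefl_10m1 (T : ℝ) (v : Pt) : prefl (1,0,-1) T v = (v.2.2 + T, v.2.1, v.1 - T) := by
  simp only [prefl, pdot, Prod.mk.injEq]; refine ⟨?_, ?_, ?_⟩ <;> ring
/-- The reflection in a cubic mirror, in coordinates. [folklore] -/
@[simp] theorem prefl_110 (T : ℝ) (v : Pt) : prefl (1,1,0) T v = (T - v.2.1, T - v.1, v.2.2) := by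
  simp only [prefl, pdot, Prod.mk.injEq]; refine ⟨?_, ?_, ?_⟩ <;> ring
/-- The reflection in a cubic mirror, in coordinates. [folklore] -/
@[simp] theorem prefl_1m10 (T : ℝ) (v : Pt) : prefl (1,-1,0) T v = (v.2.1 + T, v.1 - T, v.2.2) := by
  simp only [prefl, pdot, Prod.mk.injEq]; refine ⟨?_, ?_, ?_⟩ <;> ring
/-- The reflection in a cubic mirror, in coordinates. [folklore] -/
@[simp] theorem prefl_m110 (T : ℝ) (v : Pt) : prefl (-1,1,0) T v = (v.2.1 - T, v.1 + T, v.2.2) := by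
  simp only [prefl, pdot, Prod.mk.injEq]; refine ⟨?_, ?_, ?_⟩ <;> ring
/-- The reflection in a cubic mirror, in coordinates. [folklore] -/
@[simp] theorem prefl_010 (T : ℝ) (v : Pt) : prefl (0,1,0) T v = (v.1, 2 * T - v.2.1, v.2.2) := by
  simp only [prefl, pdot, Prod.mk.injEq]; refine ⟨?_, ?_, ?_⟩ <;> ring
/-- The reflection in a cubic mirror, in coordinates. [folklore] -/
@[simp] theorem prefl_0m10 (T : ℝ) (v : Pt) : prefl (0,-1,0) T v = (v.1, -2 * T - v.2.1, v.2.2) := by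
  simp only [prefl, pdot, Prod.mk.injEq]; refine ⟨?_, ?_, ?_⟩ <;> ring
/-- The reflection in a cubic mirror, in coordinates. [folklore] -/
@[simp] theorem prefl_001 (T : ℝ) (v : Pt) : prefl (0,0,1) T v = (v.1, v.2.1, 2 * T - v.2.2) := by
  simp only [prefl, pdot, Prod.mk.injEq]; refine ⟨?_, ?_, ?_⟩ <;> ring
/-- The reflection in a cubic mirror, in coordinates. [folklore] -/
@[simp] theorem prefl_00m1 (T : ℝ) (v : Pt) : prefl (0,0,-1) T v = (v.1, v.2.1, -2 * T - v.2.2) := by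
  simp only [prefl, pdot, Prod.mk.injEq]; refine ⟨?_, ?_, ?_⟩ <;> ring

/-! ### Thresholds: strictly below the positive values of a functional, avoiding a finite set -/

/-- There is `t ∈ (a, b)` (`a < b`) avoiding any finite set of reals. [folklore] -/
theorem exists_Ioo_not_mem (a b : ℝ) (hab : a < b) (S : Finset ℝ) : ∃ t, a < t ∧ t < b ∧ t ∉ S := by
  obtain ⟨t, ht, htS⟩ := (Set.Ioo_infinite hab).exists_notMem_finset S
  exact ⟨t, ht.1, ht.2, htS⟩

/-- The least positive value of `g` on `Q`, or `1` if there is none: a positive number `m` with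
`m ≤ g q` whenever `g q > 0`. [folklore] -/
theorem exists_pos_le_all (Q : Finset Pt) (g : Pt → ℝ) :
    ∃ m : ℝ, 0 < m ∧ ∀ q ∈ Q, 0 < g q → m ≤ g q := by
  by_cases h : (Q.filter fun q => 0 < g q).Nonempty
  · obtain ⟨m, hm, hmin⟩ := (Q.filter fun q => 0 < g q).exists_min_image g h
    exact ⟨g m, (Finset.mem_filter.1 hm).2, fun q hq hgq => hmin q (Finset.mem_filter.2 ⟨hq, hgq⟩)⟩
  · exact ⟨1, one_pos, fun q hq hgq => absurd ⟨q, Finset.mem_filter.2 ⟨hq, hgq⟩⟩ h⟩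

/-- A TINY GENERIC threshold: `0 < t`, `t < g q` for every positive value `g q` on `Q`, and `t`
outside a given finite set. [folklore] -/
theorem exists_tiny (Q : Finset Pt) (g : Pt → ℝ) (S : Finset ℝ) :
    ∃ t : ℝ, 0 < t ∧ (∀ q ∈ Q, 0 < g q → t < g q) ∧ t ∉ S := by
  obtain ⟨m, hm, hmle⟩ := exists_pos_le_all Q g
  obtain ⟨t, ht0, htm, htS⟩ := exists_Ioo_not_mem 0 m hm S
  exact ⟨t, ht0, fun q hq hgq => lt_of_lt_of_le htm (hmle q hq hgq), htS⟩

/-- With a tiny threshold no point lies on the mirror. [folklore] -/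
theorem off_mirror_of_tiny {Q : Finset Pt} {g : Pt → ℝ} {t : ℝ} (ht : 0 < t)
    (htin : ∀ q ∈ Q, 0 < g q → t < g q) : ∀ q ∈ Q, g q ≠ t := by
  intro q hq h
  have := htin q hq (h ▸ ht)
  rw [h] at this; exact lt_irrefl _ this

/-! ### PHASE 2: four good cuts make a blocker-free configuration terminal -/

/-- A BLOCKER for the target "`0` is the strict `v₁`-minimum": a point of the closed backward
`ℓ^∞`-pyramid `{p₁ ≤ −|p₂|, p₁ ≤ −|p₃|}` other than `0`. [folklore] -/
def IsBlocker (p : Pt) : Prop := p ≠ 0 ∧ p.1 ≤ -|p.2.1| ∧ p.1 ≤ -|p.2.2|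

/-- GOOD point: `0` itself or strictly positive first coordinate. [folklore] -/
def Good (p : Pt) : Prop := p = 0 ∨ 0 < p.1

/-- Non-blocker, bad, with `|p₃| ≤ −p₁`: then `|p₂| > −p₁`. [folklore] -/
theorem sticker_of_not_blocker {p : Pt} (hnb : ¬ IsBlocker p) (hp0 : p ≠ 0) (h3 : p.1 ≤ -|p.2.2|) :
    -p.1 < |p.2.1| := by
  by_contra h
  exact hnb ⟨hp0, by linarith [not_lt.1 h], h3⟩

/-- Invariant after the cuts `(e₁+e₃, t)`, `(e₁−e₃, t')`: every point is good or a `v₂`-sticker. [folklore] -/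
theorem inv_after_two {P : Finset Pt} (hnb : ∀ p ∈ P, ¬ IsBlocker p) {t t' : ℝ} (ht : 0 < t) (ht' : 0 < t')
    (H1 : ∀ p ∈ P, 0 < p.1 + p.2.2 → t < p.1 + p.2.2)
    (H2 : ∀ q ∈ pcut (1,0,1) t P, 0 < q.1 - q.2.2 → t' < q.1 - q.2.2) :
    ∀ q ∈ pcut (1,0,-1) t' (pcut (1,0,1) t P), Good q ∨ (q.1 ≤ 0 ∧ -q.1 < |q.2.1|) := by
  intro q hq
  have K1 : ∀ p ∈ P, pdot (1,0,1) p < t → p.1 + p.2.2 ≤ 0 := fun p hp hc =>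
    not_lt.1 fun h => absurd (H1 p hp h) (by simp only [pdot_101] at hc; linarith)
  have K2 : ∀ q ∈ pcut (1,0,1) t P, pdot (1,0,-1) q < t' → q.1 - q.2.2 ≤ 0 := fun q hq hc =>
    not_lt.1 fun h => absurd (H2 q hq h) (by simp only [pdot_10m1] at hc; linarith)
  rcases mem_pcut hq with ⟨hq1, hqc⟩ | ⟨p', hp', hp'c, rfl⟩
  · have hq2 := K2 q hq1 hqc
    rcases mem_pcut hq1 with ⟨hqP, hqc1⟩ | ⟨p, hp, hpc, rfl⟩
    · -- (KK) original kept twice: |q₃| ≤ −q₁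
      have h1 := K1 q hqP hqc1
      by_cases hg : Good q
      · exact Or.inl hg
      · right
        simp only [Good, not_or, not_lt] at hg
        refine ⟨hg.2, sticker_of_not_blocker (hnb q hqP) hg.1 ?_⟩
        have : |q.2.2| ≤ -q.1 := abs_le.2 ⟨by linarith, by linarith⟩
        linarith
    · -- (IK) stage-1 image of an original p (p₁ + p₃ ≤ 0), kept at stage 2
      have h1 := K1 p hp hpc
      simp only [prefl_101] at hq2 ⊢
      by_cases hg : 0 < t - p.2.2
      · exact Or.inl (Or.inr hg)
      · right
        have hg' : t - p.2.2 ≤ 0 := not_lt.1 hg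
        have hp3 : t ≤ p.2.2 := by linarith
        have hp0 : p ≠ 0 := by
          intro h0; rw [h0] at hp3; simp at hp3; linarith
        have hb := hnb p hp
        have hst : -p.1 < |p.2.1| := by
          by_contra h
          have h' : |p.2.1| ≤ -p.1 := not_lt.1 h
          apply hb
          refine ⟨hp0, by linarith, ?_⟩
          rw [abs_of_pos (by linarith : (0:ℝ) < p.2.2)]; linarith
        exact ⟨hg', by linarith⟩
  · have hp'2 := K2 p' hp' hp'c
    rcases mem_pcut hp' with ⟨hpP, hpc1⟩ | ⟨p, hp, hpc, rfl⟩
    · -- (KI) p' original kept at stage 1; its stage-2 image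
      have h1 := K1 p' hpP hpc1
      simp only [prefl_10m1]
      by_cases hg : 0 < p'.2.2 + t'
      · exact Or.inl (Or.inr hg)
      · right
        have hg : p'.2.2 + t' ≤ 0 := not_lt.1 hg
        have hp0 : p' ≠ 0 := by
          intro h0; rw [h0] at hg; simp at hg; linarith
        have hst := sticker_of_not_blocker (hnb p' hpP) hp0
          (by rw [abs_of_nonpos (by linarith : p'.2.2 ≤ 0)]; linarith)
        refine ⟨hg, ?_⟩
        have : |p'.2.2| = -p'.2.2 := abs_of_nonpos (by linarith)
        linarith [neg_abs_le p'.2.2]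
    · -- (II) p' = stage-1 image of an original p; its stage-2 image is good
      have h1 := K1 p hp hpc
      simp only [prefl_101, prefl_10m1] at hp'2 ⊢
      exact Or.inl (Or.inr (by linarith))

/-- Invariant after the third cut `(e₁+e₂, s)`: every point is good or has `q₂ < q₁ ≤ 0`. [folklore] -/
theorem inv_after_three {Q : Finset Pt} (hQ : ∀ q ∈ Q, Good q ∨ (q.1 ≤ 0 ∧ -q.1 < |q.2.1|))
    {s : ℝ} (hs : 0 < s) (H3 : ∀ q ∈ Q, 0 < q.1 + q.2.1 → s < q.1 + q.2.1) :
    ∀ r ∈ pcut (1,1,0) s Q, Good r ∨ (r.1 ≤ 0 ∧ r.2.1 < r.1) := by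
  have K3 : ∀ q ∈ Q, pdot (1,1,0) q < s → q.1 + q.2.1 ≤ 0 := fun q hq hc =>
    not_lt.1 fun h => absurd (H3 q hq h) (by simp only [pdot_110] at hc; linarith)
  intro r hr
  rcases mem_pcut hr with ⟨hrQ, hrc⟩ | ⟨q, hq, hqc, rfl⟩
  · have h3 := K3 r hrQ hrc
    rcases hQ r hrQ with hg | ⟨hr1, hst⟩
    · exact Or.inl hg
    · right; refine ⟨hr1, ?_⟩
      rcases lt_abs.1 hst with h | h <;> linarith
  · have h3 := K3 q hq hqc
    simp only [prefl_110]
    rcases hQ q hq with (rfl | hg) | ⟨hq1, hst⟩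
    · left; right; simp; linarith
    · left; right; show 0 < s - q.2.1; linarith
    · left; right; show 0 < s - q.2.1
      rcases lt_abs.1 hst with h | h <;> linarith

/-- Terminality after the fourth cut `(e₁−e₂, s')`. [folklore] -/
theorem terminal_after_four {R : Finset Pt} (hR : ∀ r ∈ R, Good r ∨ (r.1 ≤ 0 ∧ r.2.1 < r.1))
    {s' : ℝ} (hs' : 0 < s') (H4 : ∀ r ∈ R, 0 < r.1 - r.2.1 → s' < r.1 - r.2.1) :
    ∀ w ∈ pcut (1,-1,0) s' R, Good w := by
  have K4 : ∀ r ∈ R, pdot (1,-1,0) r < s' → r.1 - r.2.1 ≤ 0 := fun r hr hc =>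
    not_lt.1 fun h => absurd (H4 r hr h) (by simp only [pdot_1m10] at hc; linarith)
  have keptGood : ∀ r ∈ R, pdot (1,-1,0) r < s' → Good r := fun r hr hc => by
    rcases hR r hr with hg | ⟨_, hlt⟩
    · exact hg
    · exfalso; linarith [K4 r hr hc]
  intro w hw
  rcases mem_pcut hw with ⟨hwR, hwc⟩ | ⟨r, hr, hrc, rfl⟩
  · exact keptGood w hwR hwc
  · simp only [prefl_1m10]
    rcases keptGood r hr hrc with rfl | hg
    · right; simp; exact hs'
    · right; show 0 < r.2.1 + s'
      have := K4 r hr hrc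
      linarith

/-- **PHASE 2**: a blocker-free configuration has a mirror pedigree (four cuts in the directions
`e₁+e₃, e₁−e₃, e₁+e₂, e₁−e₂` with tiny thresholds, then `0` is the strict `v₁`-minimum). [folklore] -/
theorem hasPedigree_of_noBlocker {P : Finset Pt} (hnb : ∀ p ∈ P, ¬ IsBlocker p) : HasPedigree P := by
  obtain ⟨t, ht, H1, -⟩ := exists_tiny P (fun p => p.1 + p.2.2) ∅
  obtain ⟨t', ht', H2, -⟩ := exists_tiny (pcut (1,0,1) t P) (fun q => q.1 - q.2.2) ∅
  obtain ⟨s, hs, H3, -⟩ := exists_tiny (pcut (1,0,-1) t' (pcut (1,0,1) t P)) (fun q => q.1 + q.2.1) ∅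
  obtain ⟨s', hs', H4, -⟩ :=
    exists_tiny (pcut (1,1,0) s (pcut (1,0,-1) t' (pcut (1,0,1) t P))) (fun r => r.1 - r.2.1) ∅
  have hterm := terminal_after_four (inv_after_three (inv_after_two hnb ht ht' H1 H2) hs H3) hs' H4
  refine HasPedigree.cut (1,0,1) t (by simp [dirs]) ht ?_ <|
    HasPedigree.cut (1,0,-1) t' (by simp [dirs]) ht' ?_ <|
    HasPedigree.cut (1,1,0) s (by simp [dirs]) hs ?_ <|
    HasPedigree.cut (1,-1,0) s' (by simp [dirs]) hs' ?_ <|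
    HasPedigree.terminal (1,0,0) (by simp) fun w hw hw0 => ?_
  · intro p hp; rw [pdot_101]; exact off_mirror_of_tiny ht H1 p hp
  · intro q hq; rw [pdot_10m1]; exact off_mirror_of_tiny ht' H2 q hq
  · intro q hq; rw [pdot_110]; exact off_mirror_of_tiny hs H3 q hq
  · intro r hr; rw [pdot_1m10]; exact off_mirror_of_tiny hs' H4 r hr
  · rw [pdot_100]
    rcases hterm w hw with h | h
    · exact absurd h hw0
    · exact h

end Cover

end Summit.CriticalPhenomena.Ising3DConformalLimit.MoebiusLimitExistsNegative.Pedigree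

end
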